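import Literature.Topology.FourManifolds.LatticeFormsDefinite
import HarnessLib

/-!
# Indefinite unimodular lattices represent zero (Serre, *A Course in Arithmetic*, Ch. V §2.2 Thm 3)

Trunk T-4MAN; companion of `LatticeForms.lean`. The arithmetic input of Serre's classification of
indefinite unimodular lattices (Ch. V §2.2 Thms 4–6, the named fact
`LinearMap.BilinForm.equivalent_of_isIndefinite`), vendored as a **named fact**:

* `LinearMap.BilinForm.exists_isotropic_of_isIndefinite` — **Theorem 3**: "If `E ∈ S` is
  indefinite, `E` represents zero", i.e. a symmetric unimodular indefinite lattice has a vector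
  `x ≠ 0` with `x.x = 0`.

Serre's proof (Ch. V §3.1) is by cases on the rank `n`: `n = 2` from `d(E) = -1`; `n = 3, 4` from
Chevalley's theorem mod `p`, Hensel lifting and the Hasse–Minkowski theorem (Ch. IV §3.2 Thm 8)
with the product formula; `n ≥ 5` by Meyer's theorem (Ch. IV §3.2 Cor. 2). None of this
(quadratic forms over `ℚ_p`, Hasse–Minkowski) is in Mathlib at this pin, so the statement is
recorded as a `def … : Prop` to be taken as a hypothesis `(h : exists_isotropic_of_isIndefinite)`;
discharging it is a separate (large) task. The structural part of the classification — everything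
in Serre's §3.2–§3.5 downstream of Theorem 3 — is proved unconditionally in the sibling files and
assembled in `LatticeFormsIndefinite.lean` *from* this fact.

The statement quantifies over lattices `V : Type u` in a fixed universe `u`
(`exists_isotropic_of_isIndefinite.{u}`); `exists_isotropic_of_isIndefinite.up` lifts the
universe-`0` instance to any universe (every lattice is isometric to one on `Fin n → ℤ`), so users
may assume the `Type`-version only.

## Sources

* J.-P. Serre, *A Course in Arithmetic* (GTM 7, Springer 1973), Ch. V §2.2 Theorem 3 (statement,
  p. 53 of the held copy: "If `E ∈ S` is indefinite, `E` represents zero"), §3.1 (proof), Ch. IV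
  §3.2 Thm 8 (Hasse–Minkowski) and Cor. 2 (Meyer). [Serre1973]
* J. Milnor, D. Husemoller, *Symmetric bilinear forms* (Springer 1973), Ch. II §4–§5 (same
  reduction to Hasse–Minkowski). [MilnorHusemoller1973]
-/

open Module
open LinearMap (BilinForm)

universe u

namespace LinearMap.BilinForm

/-- **Serre's Theorem 3 (indefinite unimodular lattices represent zero)**, named fact. For every
finitely generated free `ℤ`-module `V` (in universe `u`) and every symmetric unimodular
(`IsUnimodular`, a perfect pairing) bilinear form `Q` on `V` which is indefinite (neither positive
nor negative definite, `IsIndefinite`), there is `x ≠ 0` in `V` with `Q x x = 0`.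
Serre, *A Course in Arithmetic*, Ch. V §2.2 Theorem 3 ("If `E ∈ S` is indefinite, `E` represents
zero"; proof in §3.1 via Hasse–Minkowski, Ch. IV §3.2 Thm 8, and Meyer's theorem, Cor. 2);
Milnor–Husemoller (1973), Ch. II §4–§5. Not proved in this tree (no Hasse–Minkowski in Mathlib).
[cite: Serre1973, Ch. V §2.2 Thm 3] -/
def exists_isotropic_of_isIndefinite : Prop :=
  ∀ ⦃V : Type u⦄ [AddCommGroup V] [Module ℤ V] [Module.Finite ℤ V] [Module.Free ℤ V]
    (Q : LinearMap.BilinForm ℤ V), Q.IsSymm → Q.IsUnimodular → Q.IsIndefinite →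
    ∃ x : V, x ≠ 0 ∧ Q x x = 0

/-- Theorem 3 transports along isometries: if `Q ≅ Q'` and `Q'` has a non-zero isotropic vector
then so has `Q`. [folklore] -/
theorem exists_isotropic_of_equivalent {V V' : Type*} [AddCommGroup V] [Module ℤ V]
    [AddCommGroup V'] [Module ℤ V'] {Q : LinearMap.BilinForm ℤ V} {Q' : LinearMap.BilinForm ℤ V'}
    (e : Q.Equivalent Q') (h : ∃ x : V', x ≠ 0 ∧ Q' x x = 0) : ∃ x : V, x ≠ 0 ∧ Q x x = 0 := by
  obtain ⟨f⟩ := e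
  obtain ⟨x, hx0, hx⟩ := h
  refine ⟨f.symm x, fun h0 => hx0 ?_, by rw [f.symm.map_app, hx]⟩
  simpa using congrArg f h0

/-- **Universe lifting for Theorem 3**: the statement for lattices in `Type` implies it for
lattices in any universe, since a finitely generated free `ℤ`-module of rank `n` is isometric
(for the transported form) to `Fin n → ℤ`. [folklore] -/
theorem exists_isotropic_of_isIndefinite.up (h : exists_isotropic_of_isIndefinite.{0}) :
    exists_isotropic_of_isIndefinite.{u} := by
  intro V _ _ _ _ Q hs hu hi
  -- transport `Q` to `Fin n → ℤ` along a basis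
  let e : V ≃ₗ[ℤ] (Fin (finrank ℤ V) → ℤ) := (Module.finBasis ℤ V).equivFun
  let Q' : LinearMap.BilinForm ℤ (Fin (finrank ℤ V) → ℤ) :=
    Q.comp (e.symm : (Fin (finrank ℤ V) → ℤ) →ₗ[ℤ] V) (e.symm : (Fin (finrank ℤ V) → ℤ) →ₗ[ℤ] V)
  have heq : Q.Equivalent Q' := ⟨isometryEquivOfCompLinearEquiv Q e.symm⟩
  have hs' : Q'.IsSymm := ⟨fun x y => by
    simp only [Q', comp_apply]
    exact hs.eq _ _⟩
  obtain ⟨x, hx0, hx⟩ := h Q' hs' (isUnimodular_of_equivalent heq hu)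
    ((isIndefinite_iff_of_equivalent heq).mp hi)
  exact exists_isotropic_of_equivalent heq ⟨x, hx0, hx⟩

end LinearMap.BilinForm
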